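import Summits.AtomisticToContinuum.HydrodynamicLimit.Theorems.CollisionIsometryCLTDiffuseBackwardInfluenceSupersatDefs
import HarnessLib

/-!
# The slow partners' mass bound (sub-goal (C) of `stub_stickLD`)
(crux `DiffuseBackwardInfluence`, stmt-AtomisticToContinuum-12950, line `share-nondegeneracy-one-flight`;
registered sub-goal `slow_time_integral_bound` of the occupation-time proof of `FewIdle.StickSupersat`)

For a FIXED stick `z = (x, v)` the `μ₁ = oneStickLaw θ`-mass (`μ₁ = vol_{𝕋³} ⊗ M_θ(v') dv'`,
`M_θ = localMaxwellian 1 θ 0 ≤ (2πθ)^{-3/2}` pointwise) of the partners `z' = (x', v')` that are SLOW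
(`‖v − v'‖ < w₀`) and within minimal-image distance `ε` at time `r`, integrated over `r ∈ [0, τ]`,
is at most `τ · vol(B_ε) · (2πθ)^{-3/2} · vol(B_{w₀})`:

1. Tonelli (`lintegral_lintegral_swap`; the integrand is the indicator of an open set, jointly in `(z', r)`);
2. for fixed `r`,
   `μ₁ {z' | slow and near} = ∫ vol{x' | d(P_r z, x' + r v') < ε} 1_{‖v − v'‖ < w₀} M_θ(v') dv'`,
   the inner Haar volume being `vol(B_ε)` for every `v'` (a translate of a minimal-image ball,
   `Torus.volume_euclidDist_lt`, `ε < 1/2`), and `∫_{B(v, w₀)} M_θ ≤ (2πθ)^{-3/2} vol(B_{w₀})`;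
3. integrate the constant bound over `r ∈ [0, τ]`.
-/

namespace Summit.AtomisticToContinuum.HydrodynamicLimit.Theorems.DiffuseBackwardInfluenceShare

open scoped BigOperators Topology ENNReal Classical
open Filter Set MeasureTheory Metric
open Literature.Analysis.FluidPDE
open Literature.MathematicalPhysics.KineticTheory (continuous_localMaxwellian localMaxwellian_nonneg)
open Summit.AtomisticToContinuum.HydrodynamicLimit.Theorems.DiffuseBackwardInfluenceNeg

noncomputable section

namespace FewIdle

namespace Supersat

/-- The slow-and-near set of a fixed stick is open, jointly in partner and time. [folklore] -/
theorem isOpen_setOf_slowNear (ε w₀ : ℝ) (z : T3 × V3) :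
    IsOpen {q : (T3 × V3) × ℝ | ‖z.2 - q.1.2‖ < w₀ ∧
      Torus.euclidDist (posAt q.2 z) (posAt q.2 q.1) < ε} := by
  refine IsOpen.and (isOpen_lt (by fun_prop) continuous_const) (isOpen_lt ?_ continuous_const)
  have h : Continuous fun q : (T3 × V3) × ℝ => ((z, q.1), q.2) := by fun_prop
  have h2 : Continuous fun q : (T3 × V3) × ℝ => crossDist ((z, q.1), q.2) := continuous_crossDist.comp h
  simpa only [crossDist_eq_euclidDist_posAt] using h2

/-- The slow-near indicator of a fixed stick is jointly measurable in partner and time. [folklore] -/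
theorem measurable_uncurry_slowNear (ε w₀ : ℝ) (z : T3 × V3) :
    Measurable (Function.uncurry (slowNear ε w₀ z)) := by
  have h : Function.uncurry (slowNear ε w₀ z) =
      {q : (T3 × V3) × ℝ | ‖z.2 - q.1.2‖ < w₀ ∧
        Torus.euclidDist (posAt q.2 z) (posAt q.2 q.1) < ε}.indicator 1 := by
    funext q
    rfl
  rw [h]
  exact measurable_one.indicator (isOpen_setOf_slowNear ε w₀ z).measurableSet

/-- The fixed-time slow-and-near set of a fixed stick is open. [folklore] -/
theorem isOpen_setOf_slowNear_at (ε w₀ : ℝ) (z : T3 × V3) (r : ℝ) :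
    IsOpen {z' : T3 × V3 | ‖z.2 - z'.2‖ < w₀ ∧ Torus.euclidDist (posAt r z) (posAt r z') < ε} :=
  (isOpen_setOf_slowNear ε w₀ z).preimage (f := fun z' : T3 × V3 => (z', r)) (by fun_prop)

/-- A translate of a minimal-image ball has the Haar volume of the Euclidean ball (`ε < 1/2`). [folklore] -/
theorem volume_setOf_euclidDist_posAt_lt (z : T3 × V3) {ε : ℝ} (hε : ε < 1 / 2) (r : ℝ) (v' : V3) :
    volume {x' : T3 | Torus.euclidDist (posAt r z) (posAt r (x', v')) < ε} = volume (ball (0 : V3) ε) := by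
  have h : ∀ x' : T3, Torus.euclidDist (posAt r z) (posAt r (x', v')) =
      Torus.euclidDist x' (posAt r z - Literature.Analysis.FunctionSpaces.Torus.proj (r • v')) := by
    intro x'
    have h1 : posAt r (x', v') - posAt r z =
        x' - (posAt r z - Literature.Analysis.FunctionSpaces.Torus.proj (r • v')) := by
      simp only [posAt]
      abel
    rw [Torus.euclidDist_comm, Torus.euclidDist_eq, Torus.euclidDist_eq, h1]
  simp_rw [h]
  exact Torus.volume_euclidDist_lt hε _

/-- The `x'`-slice of the fixed-time slow-and-near set has Haar volume at most `vol(B_ε) · 1_{‖v − v'‖ < w₀}`.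
[folklore] -/
theorem volume_slice_le (z : T3 × V3) {ε : ℝ} (hε : ε < 1 / 2) (w₀ r : ℝ) (v' : V3) :
    volume {x' : T3 | ‖z.2 - v'‖ < w₀ ∧ Torus.euclidDist (posAt r z) (posAt r (x', v')) < ε} ≤
      (ball z.2 w₀).indicator (fun _ => volume (ball (0 : V3) ε)) v' := by
  by_cases hv : ‖z.2 - v'‖ < w₀
  · rw [Set.indicator_of_mem (mem_ball_iff_norm'.2 hv)]
    have hset : {x' : T3 | ‖z.2 - v'‖ < w₀ ∧ Torus.euclidDist (posAt r z) (posAt r (x', v')) < ε} =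
        {x' : T3 | Torus.euclidDist (posAt r z) (posAt r (x', v')) < ε} := by
      ext x'
      simp only [mem_setOf_eq, and_iff_right hv]
    rw [hset, volume_setOf_euclidDist_posAt_lt z hε r v']
  · have hset : {x' : T3 | ‖z.2 - v'‖ < w₀ ∧ Torus.euclidDist (posAt r z) (posAt r (x', v')) < ε} = ∅ :=
      Set.subset_empty_iff.1 fun x' hx' => hv hx'.1
    rw [hset, measure_empty]
    exact zero_le

/-- The Maxwellian is bounded by its prefactor: `M_{1,0,θ}(v') ≤ (2πθ)^{-3/2}` (`θ > 0`). [folklore] -/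
theorem localMaxwellian_le_prefactor {θ : ℝ} (hθ : 0 < θ) (v' : V3) :
    localMaxwellian 1 θ (0 : V3) v' ≤ (2 * Real.pi * θ) ^ (-(Module.finrank ℝ V3 : ℝ) / 2) := by
  unfold localMaxwellian
  rw [one_mul]
  refine mul_le_of_le_one_right (Real.rpow_nonneg (by positivity) _) ?_
  rw [Real.exp_le_one_iff, neg_div]
  exact neg_nonpos.2 (by positivity)

/-- The Maxwellian mass of a velocity ball: `∫_{B(v, w₀)} M_θ ≤ (2πθ)^{-3/2} vol(B_{w₀})`. [folklore] -/
theorem withDensity_localMaxwellian_ball_le {θ : ℝ} (hθ : 0 < θ) (v : V3) (w₀ : ℝ) :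
    (volume : Measure V3).withDensity (fun v' => ENNReal.ofReal (localMaxwellian 1 θ (0 : V3) v'))
        (ball v w₀) ≤
      ENNReal.ofReal ((2 * Real.pi * θ) ^ (-(Module.finrank ℝ V3 : ℝ) / 2)) * volume (ball (0 : V3) w₀) := by
  rw [withDensity_apply _ measurableSet_ball, ← Measure.addHaar_ball_center volume v w₀,
    ← setLIntegral_const]
  exact lintegral_mono fun v' => ENNReal.ofReal_le_ofReal (localMaxwellian_le_prefactor hθ v')

/-- **Fixed time**: the `μ₁`-mass of the slow partners of `z` at minimal-image distance `< ε` at time `r` is at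
most `vol(B_ε) · (2πθ)^{-3/2} · vol(B_{w₀})`. [folklore] -/
theorem lintegral_slowNear_le {θ : ℝ} (hθ : 0 < θ) (z : T3 × V3) {ε : ℝ} (hε : ε < 1 / 2) (w₀ r : ℝ) :
    ∫⁻ z', slowNear ε w₀ z z' r ∂(oneStickLaw θ) ≤
      volume (ball (0 : V3) ε) *
        (ENNReal.ofReal ((2 * Real.pi * θ) ^ (-(Module.finrank ℝ V3 : ℝ) / 2)) * volume (ball (0 : V3) w₀)) := by
  have hA : MeasurableSet
      {z' : T3 × V3 | ‖z.2 - z'.2‖ < w₀ ∧ Torus.euclidDist (posAt r z) (posAt r z') < ε} :=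
    (isOpen_setOf_slowNear_at ε w₀ z r).measurableSet
  have h1 : ∀ z' : T3 × V3, slowNear ε w₀ z z' r =
      {z' : T3 × V3 | ‖z.2 - z'.2‖ < w₀ ∧ Torus.euclidDist (posAt r z) (posAt r z') < ε}.indicator 1 z' := by
    intro z'
    by_cases h : ‖z.2 - z'.2‖ < w₀ ∧ Torus.euclidDist (posAt r z) (posAt r z') < ε
    · rw [slowNear_eq_ite, if_pos h, Set.indicator_of_mem (by exact h)]; rfl
    · rw [slowNear_eq_ite, if_neg h, Set.indicator_of_notMem (by exact h)]
  calc ∫⁻ z', slowNear ε w₀ z z' r ∂(oneStickLaw θ)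
      = ∫⁻ z', {z' : T3 × V3 | ‖z.2 - z'.2‖ < w₀ ∧
          Torus.euclidDist (posAt r z) (posAt r z') < ε}.indicator 1 z' ∂(oneStickLaw θ) :=
        lintegral_congr h1
    _ = oneStickLaw θ {z' : T3 × V3 | ‖z.2 - z'.2‖ < w₀ ∧ Torus.euclidDist (posAt r z) (posAt r z') < ε} :=
        lintegral_indicator_one hA
    _ = ∫⁻ v', volume {x' : T3 | ‖z.2 - v'‖ < w₀ ∧ Torus.euclidDist (posAt r z) (posAt r (x', v')) < ε}
          ∂((volume : Measure V3).withDensity fun v' => ENNReal.ofReal (localMaxwellian 1 θ (0 : V3) v')) := by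
        unfold oneStickLaw
        rw [Measure.prod_apply_symm hA]
        rfl
    _ ≤ ∫⁻ v', (ball z.2 w₀).indicator (fun _ => volume (ball (0 : V3) ε)) v'
          ∂((volume : Measure V3).withDensity fun v' => ENNReal.ofReal (localMaxwellian 1 θ (0 : V3) v')) :=
        lintegral_mono fun v' => volume_slice_le z hε w₀ r v'
    _ = volume (ball (0 : V3) ε) *
          (volume : Measure V3).withDensity (fun v' => ENNReal.ofReal (localMaxwellian 1 θ (0 : V3) v'))
            (ball z.2 w₀) :=
        lintegral_indicator_const measurableSet_ball _
    _ ≤ volume (ball (0 : V3) ε) *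
          (ENNReal.ofReal ((2 * Real.pi * θ) ^ (-(Module.finrank ℝ V3 : ℝ) / 2)) * volume (ball (0 : V3) w₀)) :=
        mul_le_mul_right (withDensity_localMaxwellian_ball_le hθ z.2 w₀) _

end Supersat

end FewIdle

/-- **REGISTERED SUB-GOAL (C) — the slow partners' mass bound.** For a fixed stick `z = (x, v)`, the
`μ₁ = oneStickLaw θ`-mass of the partners `z' = (x', v')` that are slow (`‖v − v'‖ < w₀`) and within
minimal-image distance `ε < 1/2` at time `r`, integrated over `r ∈ [0, τ]`, is at most
`τ · vol(B_ε) · (2πθ)^{-3/2} · vol(B_{w₀})` (Tonelli, translation invariance of Haar measure on `𝕋³`,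
`M_θ ≤ (2πθ)^{-3/2}`). [folklore] -/
theorem slow_time_integral_bound : ∀ (θ : ℝ) [IsProbabilityMeasure (FewIdle.oneStickLaw θ)], 0 < θ → ∀ (z : T3 × V3) (ε : ℝ), ε < 1 / 2 → ∀ (τ w₀ : ℝ), ∫⁻ z', (∫⁻ r in Set.Icc 0 τ, FewIdle.Supersat.slowNear ε w₀ z z' r) ∂(FewIdle.oneStickLaw θ) ≤ ENNReal.ofReal τ * (volume (Metric.ball (0 : V3) ε) * (ENNReal.ofReal ((2 * Real.pi * θ) ^ (-(Module.finrank ℝ V3 : ℝ) / 2)) * volume (Metric.ball (0 : V3) w₀))) := by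
  intro θ _ hθ z ε hε τ w₀
  rw [lintegral_lintegral_swap (FewIdle.Supersat.measurable_uncurry_slowNear ε w₀ z).aemeasurable]
  calc ∫⁻ r in Set.Icc 0 τ, ∫⁻ z', FewIdle.Supersat.slowNear ε w₀ z z' r ∂(FewIdle.oneStickLaw θ)
      ≤ ∫⁻ _ in Set.Icc (0 : ℝ) τ, volume (Metric.ball (0 : V3) ε) *
          (ENNReal.ofReal ((2 * Real.pi * θ) ^ (-(Module.finrank ℝ V3 : ℝ) / 2)) *
            volume (Metric.ball (0 : V3) w₀)) :=
        lintegral_mono fun r => FewIdle.Supersat.lintegral_slowNear_le hθ z hε w₀ r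
    _ = volume (Metric.ball (0 : V3) ε) *
          (ENNReal.ofReal ((2 * Real.pi * θ) ^ (-(Module.finrank ℝ V3 : ℝ) / 2)) *
            volume (Metric.ball (0 : V3) w₀)) * volume (Set.Icc (0 : ℝ) τ) :=
        setLIntegral_const _ _
    _ = ENNReal.ofReal τ * (volume (Metric.ball (0 : V3) ε) *
          (ENNReal.ofReal ((2 * Real.pi * θ) ^ (-(Module.finrank ℝ V3 : ℝ) / 2)) *
            volume (Metric.ball (0 : V3) w₀))) := by
        rw [Real.volume_Icc, sub_zero, mul_comm]

end

end Summit.AtomisticToContinuum.HydrodynamicLimit.Theorems.DiffuseBackwardInfluenceShare
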